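import Summits.HodgeConjecture.HodgeConjecture.Theorems.K2E1MultiplicityOneU3DiscretePart   -- ★ p854767 (K2E1-p09): the «DISCRETE PART» dictionary this file quantifies
import HarnessLib

/-!
# K2·E1 — file #8 `K2E1MultiplicityOneU3` (Rogawski's THEOREM 13.3.1), HELPER «COUNT»: multiplicities are computed in the discrete spectrum;
# `m(π)` = the number of members of an orthogonal decomposition of `L²_disc` equivalent to `π`

Cell `hodgecm-mathlib`, Track B ∕ K2-LIT, squad K2, ENGINE E1; crux H413 = `stmt-HodgeConjecture-24833` (route `HCCMUnconditional`);
seat K2E1-p09 (g0), 2026-09-03.  PROOF FILE, lane `--supports stmt-HodgeConjecture-24833 --as helper`: THEOREMS ONLY — no definition,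
no instance, no notation, no named fact, no `sorry`.  Continuation (second topic, split for the 400-line rule) of ★
`Theorems/K2E1MultiplicityOneU3DiscretePart.lean`, which proves that multiplicity ONE of a unitary `π` is a property of ★ `π.discretePart`
and that the discrete part is an orthogonal Hilbert sum of irreducibles.  Here the QUANTITATIVE half: the tree's ★ `ContRepresentation.multiplicity`
(a supremum over finite orthogonal families in the WHOLE space) is computed inside the discrete part, and equals the COUNT of equivalent
members in any orthogonal irreducible decomposition of the discrete part — i.e. the `m(π)` of [Rogawski1990, §13.3] («the multiplicity
`m(π)` of `π` in the discrete spectrum», «`Tr ρ_d(f) = Σ m(π) Tr π(f)`», Thm. 13.3.8) IS the tree's multiplicity, also for the ISOTROPIC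
`U(2,1)` whose `L²` has continuous spectrum (★ `IsUnitary.multiplicity_eq_card_of_set` is the compact-quotient case `L²_disc = L²`).
It does NOT close the socket `sig_K2E1MultiplicityOneU3` (= Thm. 13.3.1, the engine's output; see the parent file's docstring).
HONEST LABEL: HC_CM is proved only modulo the 7 printed citations (2 remaining named inputs: hLiu418 = `stmt-HodgeConjecture-24832`, h413 =
`stmt-HodgeConjecture-24833`) until rung 0 closes; nothing here changes that count.

* §1 (any `π` on a complex inner-product space) `le_multiplicity_toContRep_of_discretePart_le`, `multiplicity_toContRep_eq_of_discretePart_le`,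
  `multiplicity_discretePart_toContRep` — the converse of ★ `ClosedSubrep.multiplicity_toContRep_le` for closed invariant subspaces containing
  the discrete part [Dixmier1977, §5.4]; (unitary `π`, complete space) `multiplicity_eq_card_of_discretePart` — for `S` pairwise orthogonal
  irreducible with `iSupClosure S = π.discretePart`, `multiplicity π σ = #{W ∈ S | W ≃ σ}` [Dixmier1977, 5.4.6].
* §2 (any ★ `AdelicGroupData`, automorphic `μ`) `multiplicity_discreteSpectrum_toContRep`, `multiplicity_eq_card_of_discreteSpectrum`.

References: [Rogawski1990] J. Rogawski, Ann. of Math. Stud. 123 (1990), §13.3 Thms. 13.3.1, 13.3.8 pp. 199–203.  [Dixmier1977] J. Dixmier,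
*C\*-algebras* (1977), §5.4 (5.4.6), §13.1.2.  [BorelJacquet1979] A. Borel, H. Jacquet, PSPM 33.1 (1979), §4.6.
-/

set_option autoImplicit false
-- the mandated namespace has the single-problem summit's repeated segment (`HodgeConjecture.HodgeConjecture`)
set_option linter.dupNamespace false

noncomputable section

namespace Summit.HodgeConjecture.HodgeConjecture.Cruxes.H413.K2E1TraceFormulaBeta.MultiplicityOneU3

open MeasureTheory NumberField
open scoped InnerProductSpace
open ContRepresentation
open Literature.NumberTheory.Automorphic

universe u

/-! ## §1 Multiplicities are computed in the discrete part: Rogawski's `m(π)` as a count in a decomposition of `L²_disc` -/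

section MultiplicityTransport

variable {G H H' : Type*} [Group G] [NormedAddCommGroup H] [InnerProductSpace ℂ H] [SeminormedAddCommGroup H'] [Module ℂ H']
  {π : ContRepresentation ℂ G H}

/-- **The multiplicity of `σ` in `π` is at most its multiplicity inside any closed invariant subspace containing the discrete part** — the
converse of ★ `ClosedSubrep.multiplicity_toContRep_le` (which holds for every `C`; the present direction fails for general `C` and holds as soon
as `π.discretePart ≤ C`): a finite family of pairwise orthogonal irreducible closed subrepresentations of `π` equivalent to `σ` lies in the
discrete part (★ `le_discretePart`), hence in `C`, and restricts (★ `restrictLE`, injective on subrepresentations `≤ C`) to such a family of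
`C.toContRep` (`isTopIrreducible_restrictLE`, `areUnitarilyEquivalent_restrictLE`, `isOrtho_restrictLE`). [cite: Dixmier1977, §5.4] -/
theorem le_multiplicity_toContRep_of_discretePart_le {C : ClosedSubrep π} (hC : π.discretePart ≤ C) (σ : ContRepresentation ℂ G H') :
    π.multiplicity σ ≤ C.toContRep.multiplicity σ := by
  classical
  unfold ContRepresentation.multiplicity
  refine iSup_le fun s => iSup_le fun hs => iSup_le fun ho => ?_
  have hle : ∀ W ∈ s, W ≤ C := fun W hW => (le_discretePart (hs W hW).1).trans hC
  have hinj : Set.InjOn C.restrictLE ↑s := by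
    intro W hW W' hW' h
    rw [← C.inflate_restrictLE (hle W (Finset.mem_coe.1 hW)), ← C.inflate_restrictLE (hle W' (Finset.mem_coe.1 hW')), h]
  have hcard : (s.image C.restrictLE).card = s.card := Finset.card_image_of_injOn hinj
  refine le_iSup_of_le (s.image C.restrictLE) (le_iSup_of_le ?_ (le_iSup_of_le ?_ (by rw [hcard])))
  · intro W₀ hW₀
    obtain ⟨W, hW, rfl⟩ := Finset.mem_image.1 hW₀
    exact ⟨C.isTopIrreducible_restrictLE (hle W hW) (hs W hW).1,
      (ClosedSubrep.areUnitarilyEquivalent_restrictLE C (hle W hW)).trans (hs W hW).2⟩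
  · intro W₀ hW₀ W₀' hW₀' hne
    obtain ⟨W, hW, rfl⟩ := Finset.mem_image.1 (Finset.mem_coe.1 hW₀)
    obtain ⟨W', hW', rfl⟩ := Finset.mem_image.1 (Finset.mem_coe.1 hW₀')
    exact isOrtho_restrictLE C (ho (Finset.mem_coe.2 hW) (Finset.mem_coe.2 hW') fun h => hne (by rw [h]))

/-- **Multiplicities are computed in any closed invariant subspace containing the discrete part**: `multiplicity C.toContRep σ =
multiplicity π σ` when `π.discretePart ≤ C` (★ `ClosedSubrep.multiplicity_toContRep_le` and `le_multiplicity_toContRep_of_discretePart_le`).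
[cite: Dixmier1977, §5.4] -/
theorem multiplicity_toContRep_eq_of_discretePart_le {C : ClosedSubrep π} (hC : π.discretePart ≤ C) (σ : ContRepresentation ℂ G H') :
    C.toContRep.multiplicity σ = π.multiplicity σ :=
  le_antisymm (ClosedSubrep.multiplicity_toContRep_le C σ) (le_multiplicity_toContRep_of_discretePart_le hC σ)

/-- **Multiplicities are computed in the discrete part**: `multiplicity π.discretePart.toContRep σ = multiplicity π σ` — Rogawski's «the
multiplicity `m(π)` of `π` in the discrete spectrum» IS the tree's multiplicity in `L²`. [cite: Dixmier1977, §5.4]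
[cite: Rogawski1990, §13.3 Thm. 13.3.1] -/
theorem multiplicity_discretePart_toContRep (σ : ContRepresentation ℂ G H') :
    π.discretePart.toContRep.multiplicity σ = π.multiplicity σ :=
  multiplicity_toContRep_eq_of_discretePart_le le_rfl σ

variable [CompleteSpace H]

/-- **Multiplicity as a count in a decomposition of the discrete part.**  If `π` is unitary and `S` is a set of pairwise orthogonal irreducible
closed subrepresentations with closed span `π.discretePart` (`L²_disc = ⊕̂_{W ∈ S} W`), then for every `σ` the multiplicity of `σ` in `π` is the
number of members of `S` unitarily equivalent to `σ` — the `m(π)` of «`ρ_d = ⊕ m(π) π`» [Rogawski1990, §13.3] equals ★ `ContRepresentation.multiplicity`,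
also for groups with continuous spectrum (★ `IsUnitary.multiplicity_eq_card_of_set` is the case `L²_disc = L²`).  Proof: pass to
`π.discretePart.toContRep` (`multiplicity_discretePart_toContRep`), which is the orthogonal sum of the restricted family
(`iSupClosure_image_restrictLE`), count there, and transport the count along `restrictLE ∕ inflate`. [cite: Dixmier1977, 5.4.6]
[cite: Rogawski1990, §13.3 Thm. 13.3.1] -/
theorem multiplicity_eq_card_of_discretePart (hπ : π.IsUnitary) {S : Set (ClosedSubrep π)}
    (hirr : ∀ W ∈ S, W.toContRep.IsTopIrreducible) (horth : S.Pairwise fun W W' => W.toSubmodule ⟂ W'.toSubmodule)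
    (hspan : ClosedSubrep.iSupClosure S = π.discretePart) (σ : ContRepresentation ℂ G H') :
    π.multiplicity σ = ENat.card {W : S // AreUnitarilyEquivalent (W : ClosedSubrep π).toContRep σ} := by
  set D : ClosedSubrep π := π.discretePart with hD
  have hS : ∀ W ∈ S, W ≤ D := fun W hW => le_discretePart (hirr W hW)
  have hirr₀ : ∀ W₀ ∈ D.restrictLE '' S, W₀.toContRep.IsTopIrreducible := by
    rintro _ ⟨W, hW, rfl⟩
    exact D.isTopIrreducible_restrictLE (hS W hW) (hirr W hW)
  have horth₀ : (D.restrictLE '' S).Pairwise fun W₀ W₀' => W₀.toSubmodule ⟂ W₀'.toSubmodule := by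
    rintro _ ⟨W, hW, rfl⟩ _ ⟨W', hW', rfl⟩ hne
    exact isOrtho_restrictLE D (horth hW hW' fun hWW' => hne (congrArg D.restrictLE hWW'))
  have hdense₀ : ClosedSubrep.iSupClosure (D.restrictLE '' S) = ⊤ := by
    rw [iSupClosure_image_restrictLE D hS, hspan, hD, ClosedSubrep.restrictLE_self]
  rw [← multiplicity_discretePart_toContRep σ, (hπ.toContRep D).multiplicity_eq_card_of_set hirr₀ horth₀ hdense₀ σ]
  apply ENat.card_congr
  refine
    { toFun := fun x => ⟨⟨D.inflate x.1.1, ?_⟩, (ClosedSubrep.areUnitarilyEquivalent_inflate D x.1.1).trans x.2⟩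
      invFun := fun y => ⟨⟨D.restrictLE y.1.1, ⟨y.1.1, y.1.2, rfl⟩⟩,
        (ClosedSubrep.areUnitarilyEquivalent_restrictLE D (hS _ y.1.2)).trans y.2⟩
      left_inv := fun x => Subtype.ext (Subtype.ext (D.restrictLE_inflate x.1.1))
      right_inv := fun y => Subtype.ext (Subtype.ext (D.inflate_restrictLE (hS _ y.1.2))) }
  obtain ⟨W, hW, hWx⟩ := x.1.2
  rw [← hWx, D.inflate_restrictLE (hS W hW)]
  exact hW

end MultiplicityTransport

/-! ## §2 Any adelic group datum -/

section AdelicCount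

variable {K : Type} [Field K] [NumberField K] (𝒢 : AdelicGroupData.{u} K) (μ : Measure 𝒢.automorphicQuotient) [𝒢.IsAutomorphicMeasure μ]

/-- **Multiplicities in `L²` are multiplicities in `L²_disc`** (★ `𝒢.discreteSpectrum μ`), for any adelic group datum and automorphic measure.
[cite: BorelJacquet1979, §4.6] [cite: Dixmier1977, §5.4] -/
theorem multiplicity_discreteSpectrum_toContRep {H' : Type*} [SeminormedAddCommGroup H'] [Module ℂ H'] (σ : ContRepresentation ℂ 𝒢.Adelic H') :
    (𝒢.discreteSpectrum μ).toContRep.multiplicity σ = (𝒢.rightRegular μ).multiplicity σ :=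
  multiplicity_discretePart_toContRep σ

/-- **`m(π)` as a count**: for an orthogonal irreducible decomposition `S` of `L²_disc` and any `σ`, the multiplicity of `σ` in `L²` is the number
of members of `S` unitarily equivalent to `σ` — the `m(π)` of [Rogawski1990, Thm. 13.3.1 ∕ 13.3.8] («`Tr ρ_d(f) = Σ m(π) Tr π(f)`») in the tree's
currency; in particular «`m(P) ≤ 1` for every discrete `P`» (the engine's target, `sig_shape_iff_forall_multiplicity_le_one`) says that no two
members of `S` are equivalent (`hasMultiplicityOne_rightRegular_iff_pairwise`). [cite: Dixmier1977, 5.4.6] [cite: Rogawski1990, §13.3 Thm. 13.3.1] -/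
theorem multiplicity_eq_card_of_discreteSpectrum {S : Set (ClosedSubrep (𝒢.rightRegular μ))}
    (hirr : ∀ W ∈ S, W.toContRep.IsTopIrreducible) (horth : S.Pairwise fun W W' => W.toSubmodule ⟂ W'.toSubmodule)
    (hspan : ClosedSubrep.iSupClosure S = 𝒢.discreteSpectrum μ)
    {H' : Type*} [SeminormedAddCommGroup H'] [Module ℂ H'] (σ : ContRepresentation ℂ 𝒢.Adelic H') :
    (𝒢.rightRegular μ).multiplicity σ = ENat.card {W : S // AreUnitarilyEquivalent (W : ClosedSubrep (𝒢.rightRegular μ)).toContRep σ} :=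
  multiplicity_eq_card_of_discretePart (𝒢.isUnitary_rightRegular μ) hirr horth hspan σ

end AdelicCount

end Summit.HodgeConjecture.HodgeConjecture.Cruxes.H413.K2E1TraceFormulaBeta.MultiplicityOneU3

end
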